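import Summits.HodgeConjecture.HodgeConjecture.Theorems.ThreefoldSquareCodimTwoChowZero
import Literature.AlgebraicGeometry.HodgeTheory.BettiKunnethPiecesHardLefschetzReduction
import Literature.AlgebraicGeometry.HodgeTheory.HodgeConjectureProductsOddHypersurfacesSupportedMiddle
import Literature.AlgebraicGeometry.HodgeTheory.ComplexConjugationHolds
import Literature.AlgebraicGeometry.Motives.HodgeTensorFactsHolds
import HarnessLib

/-!
# A threefold with `H² = N¹H²` and `N¹H³ = H³` times ANY smooth projective surface: the Hodge conjecture for `Y × S` and `S × Y`
# in every codimension — in particular for (rationally chain connected threefold) × (K3 surface, surface of general type, …)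
# (cell `hodge-nonav`, sector SQ3, target (xii) «RCC THREEFOLD × ANY SURFACE»)

PROVENANCE. Cell hodge-nonav (HUMAN RULING D-0038), planner p1 g35 target (xii) (STATUS 2026-08-28T07:56:37Z), prover seat
`hodge-nonav-19716-p2` (g3); sequel of `Theorems/ThreefoldConiveauOneOddPieces` (p614259). SUPPORT FILE
(`--supports stmt-HodgeConjecture-19654 --as helper`).

THE ARGUMENT. In the tree's two-factor criterion `BettiUniverse.hodgeConjectureFor_tensor_of_kunneth_pieces_pos_le` (with `HC(Y)`, `HC(S)`,
both of dimension `≤ 3`) only the Künneth summands `Hⁱ(Y) ⊗ Hʲ(S)` with `1 ≤ i ≤ 3`, `1 ≤ j ≤ 2`, `i + j = 2c ≥ 4` remain, i.e. `H²(Y) ⊗ H²(S)`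
and `H³(Y) ⊗ H¹(S)` in `H⁴` (the rest by hard Lefschetz, Lefschetz `(1,1)` and `HC` in dimension `≤ 3` inside the criterion). Both pass
Voisin's 2013 Lemma 2.1 on pieces (`BettiUniverse.ofRatClass_crossMap_mem_algebraicClasses_of_supportedClasses_eq_top`) with coniveau
`1 + 0 ≥ 1` — `H²(Y) = N¹`, resp. `H³(Y) = N¹H³`, and `N⁰` on the surface side; NO hypothesis on `S` (any `p_g`, any `q`) and none on `H¹(Y)`.

CONTENT (sorry-free over tree theorems; no definition, no named fact, no new axiom): **`hodgeConjectureFor_threefold_tensor_surface_of_coniveau`**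
(`HodgeConjectureFor 5 (Y ⊗ S)`), **`hodgeConjectureFor_surface_tensor_threefold_of_coniveau`** (`S ⊗ Y`), the `CH₀(Y) = pt` forms,
**`hodgeConjectureFor_threefold_tensor_surface_of_isRationallyChainConnected`** / `…surface_tensor_threefold…` (ANY rationally chain connected
threefold × ANY smooth projective surface, all codimensions — UNCONDITIONAL), the Fano forms (mod Kollár–Miyaoka–Mori).

HONEST SCOPE. Unconditional structure theorems on the stated locus (e.g. `Y` uniruled with `h^{2,0} = 0` once `CH₀(Y)` on a surface and
`H² = N¹` are supplied); `S` is arbitrary. Nothing here proves HC / HC_AV in general; rung F-H1 not moved.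

## References

* [Voisin2013GHCBloch] C. Voisin, The generalized Hodge and Bloch conjectures are equivalent for general complete intersections (2013), Lemma 2.1.
* [VoisinHodgeI2002] C. Voisin, Hodge Theory and Complex Algebraic Geometry I (2002), §6.2.3 Thm. 6.25, §11.3.3 Thm. 11.38–11.41.
* [Voisin2025] C. Voisin, Cycle classes on algebraic varieties (2025), Cor. 2.12, §4.1 Def. 4.1.
* [BlochSrinivas1983] S. Bloch, V. Srinivas, Remarks on correspondences and algebraic cycles (1983), Thm. 1.
* [Kollar1995] J. Kollár, Rational curves on algebraic varieties (1996), Def. IV.3.2 / 4.10.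
* [KollarMiyaokaMori1992] J. Kollár, Y. Miyaoka, S. Mori, J. Differential Geom. 36 (1992), Thm. 0.1.
-/

set_option linter.dupNamespace false

noncomputable section

open CategoryTheory AlgebraicGeometry MonoidalCategory CartesianMonoidalCategory Finset
open scoped TensorProduct
open Literature.AlgebraicTopology.SingularHomology
open Literature.AlgebraicGeometry Literature.AlgebraicGeometry.Motives Literature.AlgebraicGeometry.HodgeTheory
open Literature.Barriers.HodgeConjecture
open Summit.HodgeConjecture.HodgeConjecture.Theorems
open Summit.HodgeConjecture.HodgeConjecture.Theorems.CohomologicallyAlgebraic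

namespace Summit.HodgeConjecture.HodgeConjecture.Theorems.ThreefoldSquare

variable {Y S : SchemeOver ℂ}

/-- **`HC(Y × S)` in EVERY codimension for a smooth projective threefold `Y` with `H²(Y) = N¹H²(Y)`, `N¹H³(Y) = H³(Y)` and ANY smooth
projective surface `S`** — UNCONDITIONAL: only the pieces `H²(Y) ⊗ H²(S)` and `H³(Y) ⊗ H¹(S)` of `H⁴` survive the two-factor criterion, and
both have coniveau `1 + 0 ≥ 1` (Voisin 2013 Lemma 2.1 on pieces). (statement: cell hodge-nonav target (xii); e.g. a uniruled threefold with
`h^{2,0} = 0` times a K3 surface) [cite: Voisin2013GHCBloch, Lemma 2.1] [cite: VoisinHodgeI2002, §11.3.3 Thm. 11.38–11.41]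
[cite: Voisin2025, Cor. 2.12 and §4.1 Def. 4.1] -/
theorem hodgeConjectureFor_threefold_tensor_surface_of_coniveau (hY : IsSmoothProjective 3 Y) (hS : IsSmoothProjective 2 S)
    (h₂ : algebraicClasses Y 1 = ⊤) (h₃ : supportedClasses Y 3 1 = ⊤) : HodgeConjectureFor 5 (Y ⊗ S) := by
  haveI : HodgeTensorFacts.{0, 0} := hodgeTensorFacts_holds
  have hHD : exists_isReal_hodgeModel := exists_isReal_hodgeModel_holds
  have hYS : IsSmoothProjective 5 (Y ⊗ S) := hY.tensor_holds hS
  have h₂' : supportedClasses Y 2 1 = ⊤ := by simpa using h₂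
  refine BettiUniverse.hodgeConjectureFor_tensor_of_kunneth_pieces_pos_le hHD hY hS hYS
    (hodgeConjectureFor_of_dim_le_three_holds le_rfl hY) (hodgeConjectureFor_of_dim_le_three_holds (by norm_num) hS)
    fun c i j hij hi1 hi3 hj1 hj2 hc2 t ht ↦ ?_
  obtain rfl : c = 1 + 1 := by omega
  obtain ⟨rfl, rfl⟩ | ⟨rfl, rfl⟩ : i = 2 ∧ j = 2 ∨ i = 3 ∧ j = 1 := by omega
  · exact BettiUniverse.ofRatClass_crossMap_mem_algebraicClasses_of_supportedClasses_eq_top hHD hY hS hYS hij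
      (r := 1) (s := 0) (by norm_num) h₂' (supportedClasses_zero S 2) ht
  · exact BettiUniverse.ofRatClass_crossMap_mem_algebraicClasses_of_supportedClasses_eq_top hHD hY hS hYS hij
      (r := 1) (s := 0) (by norm_num) h₃ (supportedClasses_zero S 1) ht

/-- **`HC(S × Y)` in every codimension** (the mirror, by the swap `S ⊗ Y ≅ Y ⊗ S`). [cite: Voisin2013GHCBloch, Lemma 2.1]
[cite: VoisinHodgeI2002, §11.3.3 Thm. 11.38–11.41] -/
theorem hodgeConjectureFor_surface_tensor_threefold_of_coniveau (hS : IsSmoothProjective 2 S) (hY : IsSmoothProjective 3 Y)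
    (h₂ : algebraicClasses Y 1 = ⊤) (h₃ : supportedClasses Y 3 1 = ⊤) : HodgeConjectureFor 5 (S ⊗ Y) := by
  have hYS : IsSmoothProjective 5 (Y ⊗ S) := hY.tensor_holds hS
  have hSY : IsSmoothProjective 5 (S ⊗ Y) := hS.tensor_holds hY
  let swap : S ⊗ Y ≅ Y ⊗ S :=
    { hom := lift (snd _ _) (fst _ _)
      inv := lift (snd _ _) (fst _ _)
      hom_inv_id := by ext <;> simp
      inv_hom_id := by ext <;> simp }
  exact hodgeConjectureFor_of_iso swap hYS hSY (hodgeConjectureFor_threefold_tensor_surface_of_coniveau hY hS h₂ h₃)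

/-- **`CH₀(Y)` supported on a point (e.g. `Y` rationally connected): `HC(Y × S)` for ANY smooth projective surface `S`.**
[cite: BlochSrinivas1983, Thm. 1] [cite: VoisinHodgeII2003, Thm. 10.17 and Cor. 10.18] -/
theorem hodgeConjectureFor_threefold_tensor_surface_of_hasChowZeroSupportedInDimLE_zero (hY : IsSmoothProjective 3 Y)
    (hS : IsSmoothProjective 2 S) (hW : HasChowZeroSupportedInDimLE Y 0) : HodgeConjectureFor 5 (Y ⊗ S) :=
  hodgeConjectureFor_threefold_tensor_surface_of_coniveau hY hS (algebraicClasses_one_eq_top_of_hasChowZeroSupportedInDimLE_zero hY hW)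
    (supportedClasses_eq_top_of_hasChowZeroSupportedInDimLE_of_lt hY hW (by norm_num))

/-- **ANY rationally chain connected smooth projective threefold times ANY smooth projective surface satisfies the Hodge conjecture in every
codimension — UNCONDITIONALLY** (e.g. `Y × K3`, `Y × (surface of general type)`). [cite: Kollar1995, Def. IV.3.2 (4.10)]
[cite: BlochSrinivas1983, Thm. 1] [cite: Voisin2013GHCBloch, Lemma 2.1] -/
theorem hodgeConjectureFor_threefold_tensor_surface_of_isRationallyChainConnected (hY : IsSmoothProjective 3 Y)
    (hRC : IsRationallyChainConnected Y) (hS : IsSmoothProjective 2 S) : HodgeConjectureFor 5 (Y ⊗ S) :=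
  hodgeConjectureFor_threefold_tensor_surface_of_hasChowZeroSupportedInDimLE_zero hY hS (hRC.hasChowZeroSupportedInDimLE_zero hY)

/-- The mirror: **ANY smooth projective surface times ANY rationally chain connected threefold.** [cite: Kollar1995, Def. IV.3.2 (4.10)]
[cite: BlochSrinivas1983, Thm. 1] -/
theorem hodgeConjectureFor_surface_tensor_threefold_of_isRationallyChainConnected (hS : IsSmoothProjective 2 S)
    (hY : IsSmoothProjective 3 Y) (hRC : IsRationallyChainConnected Y) : HodgeConjectureFor 5 (S ⊗ Y) :=
  hodgeConjectureFor_surface_tensor_threefold_of_coniveau hS hY (algebraicClasses_one_eq_top_of_hasChowZeroSupportedInDimLE_zero hY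
    (hRC.hasChowZeroSupportedInDimLE_zero hY))
    (supportedClasses_eq_top_of_hasChowZeroSupportedInDimLE_of_lt hY (hRC.hasChowZeroSupportedInDimLE_zero hY) (by norm_num))

/-- **A smooth Fano threefold times any smooth projective surface, modulo Kollár–Miyaoka–Mori.** CONDITIONAL on that named fact.
[cite: KollarMiyaokaMori1992, Thm. 0.1] [cite: BlochSrinivas1983, Thm. 1] -/
theorem hodgeConjectureFor_threefold_tensor_surface_of_isFano (hK : KollarMiyaokaMori1992_fano_rationallyChainConnected)
    (hF : IsFano 3 Y) (hS : IsSmoothProjective 2 S) : HodgeConjectureFor 5 (Y ⊗ S) :=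
  hodgeConjectureFor_threefold_tensor_surface_of_isRationallyChainConnected hF.isSmoothProjective (hK hF) hS

end Summit.HodgeConjecture.HodgeConjecture.Theorems.ThreefoldSquare

end
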